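import Summits.Ventures.HodgeRepro2.T5CMFieldCyclicGaloisCriterion
import Summits.Ventures.HodgeRepro2.T5RecordSatakeCyclotomicCells

/-!
# THE SATAKE CHAIN OF THE RECORD'S PAIR ON EVERY SEXTIC GALOIS CM FIELD: at every place `v` of `K⁺` above an
# unramified `p` with `f(P/p)` even, the cells, `deg Tₙ = (q³ + 1) q^{4n−3}` and the tree recursion hold with
# `q = N(v) = p^{f(v/p)} ∈ {p, p³}`

Tier-5 support N3 / §G-N4.2 (seat p3, gen 80). Files 251 / 278 read the datum-free cells theorem of the record's
pair `(U(1 ⊗ H), K_v)` at every place that stays prime, with `q = N(v)`, and made `q` explicit on the cyclotomic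
family (`q = p^{o/2}`). For the brief's «sextic Galois CM case» the residue cardinality is `N(v) = p^{f(v/p)}` with
`f(v/p) ∈ {1, 3}` (`K⁺` is a cyclic cubic field, file 281), and «`v` stays prime» is «`f(P/p)` even» (file 281):

* `absNorm_eq_pow_inertiaDeg` — `N(v) = p^{f(v/p)}` for every CM field (Mathlib's `absNorm_pow_inertiaDeg`);
* **`exists_cells_ncard_and_three_term_record_of_map_eq`** — for every CM field, at every place `v` of `K⁺` above
  `p` that stays prime in `K` (`v 𝓞_K = w`), every hermitian `H` with unit determinant good at `w`, every generator
  family `l` and every field `k` of characteristic `0`: cells `gₙ ∈ U(1 ⊗ H)` with `deg Tₙ = (q³ + 1) q^{4n−3}`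
  (`n ≥ 1`), `deg T₀ = 1`, `T₁ T_{n+2} = T_{n+3} + (q − 1) T_{n+2} + q⁴ T_{n+1}`, `T₁² = T₂ + (q − 1) T₁ + (q⁴ + q) T₀`,
  `q = p^{f(v/p)}`;
* `inertiaDeg_over_eq_two_of_ncard_eq_one`, `inertiaDeg_eq_two_mul_of_ncard_eq_one`, `absNorm_eq_pow_inertiaDeg_div_two`
  — at a non-split `v` with `p` unramified: `f(P/v) = 2`, `f(P/p) = 2 f(v/p)`, `q = N(v) = p^{f(P/p)/2}` (every CM field);
* SEXTIC: `absNorm_eq_or` (`N(v) = p ∨ N(v) = p³`), **`exists_cells_ncard_and_three_term_record_sextic`** — the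
  same at every place `v` of `K⁺` lying under a prime `P` of `K` above an unramified `p` with `f(P/p)` even (the
  inert regime of the sextic case, `f(P/p) ∈ {2, 6}`), `q = p^{f(v/p)}`, `f(v/p) = 1 ∨ f(v/p) = 3` and
  `f(P/p) = 2 f(v/p)`.

§8(d): uses an L-value-free non-vanishing device: NO.
-/

open Matrix NumberField NumberField.IsCMField IsDedekindDomain IsDedekindDomain.HeightOneSpectrum Module Polynomial
  MulAction
open scoped TensorProduct Pointwise
open Summit.Ventures.HodgeRepro2.T5UnitaryGroupForm Summit.Ventures.HodgeRepro2.T5UnitaryHeckeAdjoint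
  Summit.Ventures.HodgeRepro2.T5HeckePermutationModule Summit.Ventures.HodgeRepro2.T5HeckeDoubleCoset
  Summit.Ventures.HodgeRepro2.T5RecordHyperspecial Summit.Ventures.HodgeRepro2.T5GlobalLatticeAlmostAll
  Summit.Ventures.HodgeRepro2.T5FinitePlaceSplitClassification Summit.Ventures.HodgeRepro2.T5RecordSatakeIntrinsic
  Summit.Ventures.HodgeRepro2.T5CMFieldSquareDatum Summit.Ventures.HodgeRepro2.T5RecordSatakeToy
  Summit.Ventures.HodgeRepro2.T5RecordSatakeDegreeIntrinsic
  Summit.Ventures.HodgeRepro2.T5RecordSatakeRecurrenceIntrinsic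
  Summit.Ventures.HodgeRepro2.T5SplitPlaceUnitaryGroup Summit.Ventures.HodgeRepro2.T5NonSplitPlaceUnitaryGroup
  Summit.Ventures.HodgeRepro2.T5FinitePlaceCM Summit.Ventures.HodgeRepro2.T5StarOfInvolution
  Summit.Ventures.HodgeRepro2.T5RecordSatake Summit.Ventures.HodgeRepro2.T5RecordSatakeInert
  Summit.Ventures.HodgeRepro2.T5RecordSatakeCell Summit.Ventures.HodgeRepro2.T5RecordSatakeDegree
  Summit.Ventures.HodgeRepro2.T5RecordSatakeRecurrence Summit.Ventures.HodgeRepro2.T5RecordSatakeInertToyDegree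
  Summit.Ventures.HodgeRepro2.T5RecordSatakeDegreeCells Summit.Ventures.HodgeRepro2.T5CyclotomicSevenHeckeCommutative
  Summit.Ventures.HodgeRepro2.T5CMFieldCyclicGaloisCriterion

namespace Summit.Ventures.HodgeRepro2.T5SexticRecordSatake

section Norm

variable (K : Type*) [Field K] [NumberField K] [IsCMField K]
variable (p : ℕ) [hp : Fact p.Prime]
variable (v : HeightOneSpectrum (𝓞 (maximalRealSubfield K))) [hv : v.asIdeal.LiesOver (Ideal.span {(p : ℤ)})]

omit [IsCMField K] hp in
/-- **`N(v) = p^{f(v/p)}`** for every place `v` of `K⁺` above `p` (Mathlib's `Ideal.absNorm_pow_inertiaDeg` with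
`N((p)) = p`). -/
theorem absNorm_eq_pow_inertiaDeg : Ideal.absNorm v.asIdeal = p ^ v.asIdeal.inertiaDeg ℤ := by
  have h := Ideal.absNorm_pow_inertiaDeg (Ideal.span {(p : ℤ)}) v.asIdeal
  rw [T5CyclotomicSevenInertPrime.absNorm_span_natCast_int] at h
  exact h.symm

omit hp in
/-- **THE CELLS, THEIR DEGREES AND THE TREE RECURSION OF THE RECORD'S PAIR AT A PLACE THAT STAYS PRIME, WITH
`q = p^{f(v/p)}`** (file 251's datum-free theorem with `N(v) = p^{f(v/p)}`): for every CM field `K`, every place `v`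
of `K⁺` above `p` with `v 𝓞_K = w`, every hermitian `H ∈ M₃(K)` with unit determinant and `w ∉ badSet H`, every
family `l` of generators of `𝓞_K` over `𝓞_{K⁺}` and every field `k` of characteristic `0`: cells `gₙ ∈ U(1 ⊗ H)` with
`#(K_v gₙ K_v / K_v) = (q³ + 1) q^{4n−3}` (`n ≥ 1`), `#(K_v g₀ K_v / K_v) = 1`, and `Tₙ := 1_{K_v gₙ K_v}` satisfying
`T₁ T_{n+2} = T_{n+3} + (q − 1) T_{n+2} + q⁴ T_{n+1}` and `T₁² = T₂ + (q − 1) T₁ + (q⁴ + q) T₀`. -/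
theorem exists_cells_ncard_and_three_term_record_of_map_eq (w : HeightOneSpectrum (𝓞 K))
    (hmap : Ideal.map (algebraMap (𝓞 (maximalRealSubfield K)) (𝓞 K)) v.asIdeal = w.asIdeal)
    {r : ℕ} (l : Fin r → 𝓞 K) (k : Type*) [Field k] [CharZero k]
    (hl : Submodule.span (𝓞 (maximalRealSubfield K)) (Set.range l) = ⊤)
    {H : Matrix (Fin 3) (Fin 3) K} (hH : H.IsHermitian) (hdet : IsUnit H.det) (hbad : w ∉ badSet H) :
    ∃ g : ℕ → (letI := tensorStarRing K v; ↥(formUnitaryGroup (tensorGram K v H))),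
      (∀ n, 1 ≤ n → (orbit (recordHyperspecial K v l H)
        (g n : _ ⧸ recordHyperspecial K v l H)).ncard =
          ((p ^ v.asIdeal.inertiaDeg ℤ) ^ 3 + 1) * (p ^ v.asIdeal.inertiaDeg ℤ) ^ (4 * n - 3)) ∧
      (orbit (recordHyperspecial K v l H) (g 0 : _ ⧸ recordHyperspecial K v l H)).ncard = 1 ∧
      ∃ hfin : ∀ n, Finite (orbit (recordHyperspecial K v l H) (g n : _ ⧸ recordHyperspecial K v l H)),
        (∀ n, letI := hfin 1; letI := hfin (n + 1 + 1); letI := hfin (n + 1 + 1 + 1); letI := hfin (n + 1);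
          doubleCosetOp k (recordHyperspecial K v l H) (g 1) *
              doubleCosetOp k (recordHyperspecial K v l H) (g (n + 1 + 1)) =
            doubleCosetOp k (recordHyperspecial K v l H) (g (n + 1 + 1 + 1)) +
              ((p : k) ^ v.asIdeal.inertiaDeg ℤ - 1) •
                doubleCosetOp k (recordHyperspecial K v l H) (g (n + 1 + 1)) +
              ((p : k) ^ v.asIdeal.inertiaDeg ℤ) ^ 4 •
                doubleCosetOp k (recordHyperspecial K v l H) (g (n + 1))) ∧
        (letI := hfin 1; letI := hfin (0 + 1); letI := hfin (0 + 1 + 1); letI := hfin 0;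
          doubleCosetOp k (recordHyperspecial K v l H) (g 1) *
              doubleCosetOp k (recordHyperspecial K v l H) (g (0 + 1)) =
            doubleCosetOp k (recordHyperspecial K v l H) (g (0 + 1 + 1)) +
              ((p : k) ^ v.asIdeal.inertiaDeg ℤ - 1) •
                doubleCosetOp k (recordHyperspecial K v l H) (g (0 + 1)) +
              (((p : k) ^ v.asIdeal.inertiaDeg ℤ) ^ 4 + (p : k) ^ v.asIdeal.inertiaDeg ℤ) •
                doubleCosetOp k (recordHyperspecial K v l H) (g 0)) := by
  have hN := absNorm_eq_pow_inertiaDeg K p v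
  have e1 : ((Ideal.absNorm v.asIdeal : k) - 1) = (p : k) ^ v.asIdeal.inertiaDeg ℤ - 1 := by
    rw [hN, Nat.cast_pow]
  have e2 : (Ideal.absNorm v.asIdeal : k) ^ 4 = ((p : k) ^ v.asIdeal.inertiaDeg ℤ) ^ 4 := by
    rw [hN, Nat.cast_pow]
  have e3 : (Ideal.absNorm v.asIdeal : k) ^ 4 + Ideal.absNorm v.asIdeal =
      ((p : k) ^ v.asIdeal.inertiaDeg ℤ) ^ 4 + (p : k) ^ v.asIdeal.inertiaDeg ℤ := by
    rw [hN, Nat.cast_pow]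
  haveI := liesOver_of_map_eq K v w hmap
  have key := exists_cells_three_term_and_ncard_record_of_staysPrime' K v w hmap l k hl hH hdet hbad
  refine key.elim fun g hg => ⟨g, fun n hn' => ?_, hg.2.1, ?_⟩
  · rw [← hN]
    exact hg.1 n hn'
  · refine hg.2.2.elim fun hfin hh => ⟨hfin, fun n => ?_, ?_⟩
    · exact three_term_congr e1 e2 (hh.1 n)
    · exact three_term_congr e1 e3 hh.2

end Norm

section Tower

variable (K : Type*) [Field K] [NumberField K] [IsCMField K]
variable (p : ℕ) [hp : Fact p.Prime]
variable (v : HeightOneSpectrum (𝓞 (maximalRealSubfield K)))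
variable (P : Ideal (𝓞 K)) [hP : P.IsPrime] [hPp : P.LiesOver (Ideal.span {(p : ℤ)})] [hPv : P.LiesOver v.asIdeal]

omit hp hPp in
/-- **`f(P/v) = 2` at a non-split place `v` with `p` unramified** (file 125's `e(P/v) f(P/v) = 2` with `e(P/v) = 1`). -/
theorem inertiaDeg_over_eq_two_of_ncard_eq_one (he : P.ramificationIdx ℤ = 1)
    (h1 : (v.asIdeal.primesOver (𝓞 K)).ncard = 1) :
    P.inertiaDeg (𝓞 (maximalRealSubfield K)) = 2 := by
  have h := T5FinitePlaceLocalDegree.ramificationIdx_mul_inertiaDeg_eq_two K v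
    ⟨P, hP, Ideal.ne_bot_of_liesOver_of_ne_bot v.ne_bot P⟩ h1
  change P.ramificationIdx (𝓞 (maximalRealSubfield K)) * P.inertiaDeg (𝓞 (maximalRealSubfield K)) = 2 at h
  rw [T5CMFieldCyclicGaloisCriterion.ramificationIdx_over_eq_one_of_eq_one K P v he, one_mul] at h
  exact h

omit hp hPp in
/-- **`f(P/p) = 2 f(v/p)`** at a non-split place with `p` unramified (the inertia tower law). -/
theorem inertiaDeg_eq_two_mul_of_ncard_eq_one (he : P.ramificationIdx ℤ = 1)
    (h1 : (v.asIdeal.primesOver (𝓞 K)).ncard = 1) :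
    P.inertiaDeg ℤ = 2 * v.asIdeal.inertiaDeg ℤ := by
  rw [Ideal.inertiaDeg_tower (R := ℤ) v.asIdeal P, inertiaDeg_over_eq_two_of_ncard_eq_one K v P he h1, mul_comm]

omit hp in
/-- **`q = N(v) = p^{f(P/p)/2}`** at a non-split place with `p` unramified — the form of files 273 / 278
(`q = p^{o/2}`) for every CM field. -/
theorem absNorm_eq_pow_inertiaDeg_div_two (he : P.ramificationIdx ℤ = 1)
    (h1 : (v.asIdeal.primesOver (𝓞 K)).ncard = 1) :
    Ideal.absNorm v.asIdeal = p ^ (P.inertiaDeg ℤ / 2) := by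
  haveI : v.asIdeal.LiesOver (Ideal.span {(p : ℤ)}) := Ideal.LiesOver.tower_bot P v.asIdeal (Ideal.span {(p : ℤ)})
  rw [absNorm_eq_pow_inertiaDeg K p v, inertiaDeg_eq_two_mul_of_ncard_eq_one K v P he h1,
    Nat.mul_div_cancel_left _ two_pos]

end Tower

section Sextic

variable (K : Type*) [Field K] [NumberField K] [IsCMField K] [IsGalois ℚ K] (h6 : Module.finrank ℚ K = 6)
variable (p : ℕ) [hp : Fact p.Prime]
variable (v : HeightOneSpectrum (𝓞 (maximalRealSubfield K))) [hv : v.asIdeal.LiesOver (Ideal.span {(p : ℤ)})]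
include h6

/-- **`N(v) = p` or `N(v) = p³`** for every place `v` of `K⁺` above `p`, `K` a sextic Galois CM field (`f(v/p) ∈
{1, 3}`, file 281). -/
theorem absNorm_eq_or : Ideal.absNorm v.asIdeal = p ∨ Ideal.absNorm v.asIdeal = p ^ 3 := by
  rw [absNorm_eq_pow_inertiaDeg K p v]
  rcases T5CMFieldCyclicGaloisCriterion.inertiaDeg_under_eq_one_or_three K h6 p v with h | h
  · left
    rw [h, pow_one]
  · right
    rw [h]

variable (P : Ideal (𝓞 K)) [hP : P.IsPrime] [hPp : P.LiesOver (Ideal.span {(p : ℤ)})] [hPv : P.LiesOver v.asIdeal]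

/-- **THE SATAKE CHAIN OF THE RECORD'S PAIR ON EVERY SEXTIC GALOIS CM FIELD, IN THE INERT REGIME**: for a prime `P`
of `K` above `v` and an unramified `p` with `f(P/p)` EVEN (`f(P/p) ∈ {2, 6}`), every hermitian `H` with unit
determinant good at every place of `K` above `v`, every generator family `l` and every field `k` of characteristic
`0`: the cells `gₙ ∈ U(1 ⊗ H)` with `deg Tₙ = (q³ + 1) q^{4n−3}`, `deg T₀ = 1` and the tree recursion, with
`q = p^{f(v/p)}`, `f(v/p) = 1 ∨ f(v/p) = 3` and `f(P/p) = 2 f(v/p)` (so `q = p^{f(P/p)/2} ∈ {p, p³}`). -/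
theorem exists_cells_ncard_and_three_term_record_sextic (he : P.ramificationIdx ℤ = 1)
    (heven : Even (P.inertiaDeg ℤ)) {r : ℕ} (l : Fin r → 𝓞 K) (k : Type*) [Field k] [CharZero k]
    (hl : Submodule.span (𝓞 (maximalRealSubfield K)) (Set.range l) = ⊤)
    {H : Matrix (Fin 3) (Fin 3) K} (hH : H.IsHermitian) (hdet : IsUnit H.det)
    (hbad : ∀ w : HeightOneSpectrum (𝓞 K), w.asIdeal.LiesOver v.asIdeal → w ∉ badSet H) :
    (v.asIdeal.inertiaDeg ℤ = 1 ∨ v.asIdeal.inertiaDeg ℤ = 3) ∧ P.inertiaDeg ℤ = 2 * v.asIdeal.inertiaDeg ℤ ∧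
    ∃ g : ℕ → (letI := tensorStarRing K v; ↥(formUnitaryGroup (tensorGram K v H))),
      (∀ n, 1 ≤ n → (orbit (recordHyperspecial K v l H)
        (g n : _ ⧸ recordHyperspecial K v l H)).ncard =
          ((p ^ v.asIdeal.inertiaDeg ℤ) ^ 3 + 1) * (p ^ v.asIdeal.inertiaDeg ℤ) ^ (4 * n - 3)) ∧
      (orbit (recordHyperspecial K v l H) (g 0 : _ ⧸ recordHyperspecial K v l H)).ncard = 1 ∧
      ∃ hfin : ∀ n, Finite (orbit (recordHyperspecial K v l H) (g n : _ ⧸ recordHyperspecial K v l H)),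
        (∀ n, letI := hfin 1; letI := hfin (n + 1 + 1); letI := hfin (n + 1 + 1 + 1); letI := hfin (n + 1);
          doubleCosetOp k (recordHyperspecial K v l H) (g 1) *
              doubleCosetOp k (recordHyperspecial K v l H) (g (n + 1 + 1)) =
            doubleCosetOp k (recordHyperspecial K v l H) (g (n + 1 + 1 + 1)) +
              ((p : k) ^ v.asIdeal.inertiaDeg ℤ - 1) •
                doubleCosetOp k (recordHyperspecial K v l H) (g (n + 1 + 1)) +
              ((p : k) ^ v.asIdeal.inertiaDeg ℤ) ^ 4 •
                doubleCosetOp k (recordHyperspecial K v l H) (g (n + 1))) ∧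
        (letI := hfin 1; letI := hfin (0 + 1); letI := hfin (0 + 1 + 1); letI := hfin 0;
          doubleCosetOp k (recordHyperspecial K v l H) (g 1) *
              doubleCosetOp k (recordHyperspecial K v l H) (g (0 + 1)) =
            doubleCosetOp k (recordHyperspecial K v l H) (g (0 + 1 + 1)) +
              ((p : k) ^ v.asIdeal.inertiaDeg ℤ - 1) •
                doubleCosetOp k (recordHyperspecial K v l H) (g (0 + 1)) +
              (((p : k) ^ v.asIdeal.inertiaDeg ℤ) ^ 4 + (p : k) ^ v.asIdeal.inertiaDeg ℤ) •
                doubleCosetOp k (recordHyperspecial K v l H) (g 0)) := by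
  haveI := T5CMFieldCyclicGaloisCriterion.isCyclic_gal K h6
  refine ⟨T5CMFieldCyclicGaloisCriterion.inertiaDeg_under_eq_one_or_three K h6 p v,
    inertiaDeg_eq_two_mul_of_ncard_eq_one K v P he
      ((T5CMFieldCyclicGaloisCriterion.ncard_primesOver_eq_one_iff_even_inertiaDeg K p P v he).mpr heven), ?_⟩
  refine ((T5CMFieldCyclicGaloisCriterion.exists_map_eq_iff_even_inertiaDeg_sextic K h6 p P v he).mpr
    heven).elim fun w hmap => ?_
  exact exists_cells_ncard_and_three_term_record_of_map_eq K p v w hmap l k hl hH hdet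
    (hbad w (liesOver_of_map_eq K v w hmap))

end Sextic

end Summit.Ventures.HodgeRepro2.T5SexticRecordSatake
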